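import Mathlib
import Summits.KontsevichZagierPeriods.KontsevichZagierPeriods.Theorems.IsogenyCertificatesRichelotChainCerts
import Summits.KontsevichZagierPeriods.KontsevichZagierPeriods.Theorems.IsogenyCertificatesRichelotChainCorr

/-!
# `RichelotChain` (stmt-KontsevichZagierPeriods-6732): the interval `(36, 60) ↔ (40, 45)`

Last bounded root intervals of `Ĉ : w² = F̂(z) = (z+15)(z−9)(z−10)(z−34)(z−36)(z−60)` and
`C : y² = F(x) = x(x−6)(x−13)(x−30)(x−40)(x−45)` (`F̂ < 0`, `F < 0` there):
`[(36,60), (α+βz)/√|F̂|] ~ [(40,45), (α+βx)/√|F|]`, by the two real sheets of the Richelot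
correspondence `Z₁ : Φ⁰(x,z) = 0` over `z ∈ (36,45)` and `z ∈ (45,60)`, each the LARGER `x`-root of
`Φ⁰(·,z)` (the smaller one lies in `(13,30)`), mapping onto `(40,45)`; trace certificate
`cert0_trace_x`. Interval-specific sign bookkeeping: `disc_x Φ⁰ = 25(z+18)(z−10)(z−34)(1530−23z)`,
`Φ⁰(40,z) = 450(z−36)(z−60)`, `Φ⁰(45,z) = 650(z−45)²`, `Φ⁰(13,z) = 234(z+15)(z−9)`,
`Φ⁰(30,z) = 200(z−36)(z−60)`, `Φ⁰(x,36) = 702(x−30)(x−40)`, `Φ⁰(x,x) = x(x−45)(x−10)(x−34)`,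
`Φ⁰(x,45) = 45(x−45)(23x−650)`, `Φ⁰(x,60) = 1950(x−30)(x−40)`.

References: J.-B. Bost, J.-F. Mestre, Gaz. Math. 38 (1988), §2; M. Kontsevich, D. Zagier, *Periods*
(2001), §1.2.
-/

noncomputable section

open Set MeasureTheory
open Literature.NumberTheory.Transcendental Literature.ModelTheory.ExponentialFields

namespace Summit.KontsevichZagierPeriods.IsogenyCertificates.RichelotChain

/-- **`RichelotChain`, interval `k = 4`:** `[(36,60), (α+βz)/√|F̂|] ~ [(40,45), 1·(α+βx)/√|F|]`.
[cite: BostMestre1988, §2] -/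
theorem sheet_k4 (α β : ℚ) (r r' : KZ.IntegralRep 1)
    (h1 : r.domain = {z | (36 : ℝ) < z 0 ∧ z 0 < 60})
    (h2 : EqOn r.integrand (fun z => ((α : ℝ) + (β : ℝ) * z 0) /
      Real.sqrt |(z 0 + 15) * (z 0 - 9) * (z 0 - 10) * (z 0 - 34) * (z 0 - 36) * (z 0 - 60)|) r.domain)
    (h3 : r'.domain = {x | (40 : ℝ) < x 0 ∧ x 0 < 45})
    (h4 : EqOn r'.integrand (fun x => (1 : ℝ) * ((α : ℝ) + (β : ℝ) * x 0) /
      Real.sqrt |x 0 * (x 0 - 6) * (x 0 - 13) * (x 0 - 30) * (x 0 - 40) * (x 0 - 45)|) r'.domain) :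
    KZ.Equivalent r r' := by
  -- the data of the correspondence `Z₁`, in the `x`-root direction
  set a : ℝ → ℝ := fun t => t ^ 2 - 44 * t + 990 with ha_def
  set b : ℝ → ℝ := fun t => -45 * t ^ 2 + 680 * t - 15300 with hb_def
  set c : ℝ → ℝ := fun t => 650 * t ^ 2 with hc_def
  set a₁ : ℝ → ℝ := fun t => 2 * t - 44 with ha₁_def
  set b₁ : ℝ → ℝ := fun t => -90 * t + 680 with hb₁_def
  set c₁ : ℝ → ℝ := fun t => 1300 * t with hc₁_def
  set P : ℝ → ℝ := fun y => y ^ 2 - 45 * y + 650 with hP_def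
  set Q : ℝ → ℝ := fun y => -44 * y ^ 2 + 680 * y with hQ_def
  set R : ℝ → ℝ := fun y => 990 * y ^ 2 - 15300 * y with hR_def
  set Ft : ℝ → ℝ := fun y => y * (y - 6) * (y - 13) * (y - 30) * (y - 40) * (y - 45) with hFt_def
  set Fs : ℝ → ℝ := fun t => (t + 15) * (t - 9) * (t - 10) * (t - 34) * (t - 36) * (t - 60) with hFs_def
  set Ψ : ℝ → ℝ → ℝ := fun y t => 25 * (y - 6) * (y - 13) * (t - 36) * (t - 60) * (y - t) with hΨ_def
  have defs : (∀ t, a t = t ^ 2 - 44 * t + 990) ∧ (∀ t, b t = -45 * t ^ 2 + 680 * t - 15300) ∧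
      (∀ t, c t = 650 * t ^ 2) ∧ (∀ t, a₁ t = 2 * t - 44) ∧ (∀ t, b₁ t = -90 * t + 680) ∧
      (∀ t, c₁ t = 1300 * t) ∧ (∀ y, P y = y ^ 2 - 45 * y + 650) ∧ (∀ y, Q y = -44 * y ^ 2 + 680 * y) ∧
      (∀ y, R y = 990 * y ^ 2 - 15300 * y) ∧
      (∀ y, Ft y = y * (y - 6) * (y - 13) * (y - 30) * (y - 40) * (y - 45)) ∧
      (∀ t, Fs t = (t + 15) * (t - 9) * (t - 10) * (t - 34) * (t - 36) * (t - 60)) ∧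
      (∀ y t, Ψ y t = 25 * (y - 6) * (y - 13) * (t - 36) * (t - 60) * (y - t)) :=
    ⟨fun _ => rfl, fun _ => rfl, fun _ => rfl, fun _ => rfl, fun _ => rfl, fun _ => rfl, fun _ => rfl,
      fun _ => rfl, fun _ => rfl, fun _ => rfl, fun _ => rfl, fun _ _ => rfl⟩
  obtain ⟨ea, eb, ec, ea₁, eb₁, ec₁, eP, eQ, eR, eFt, eFs, eΨ⟩ := defs
  -- hypotheses of `correspondence_transfer`
  have hexp : ∀ y t : ℝ, a t * y ^ 2 + b t * y + c t = P y * t ^ 2 + Q y * t + R y := by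
    intro y t; rw [ea, eb, ec, eP, eQ, eR]; ring
  have hda : ∀ t, HasDerivAt a (a₁ t) t := fun t =>
    (hasDerivAt_quad 1 (-44) 990 t (fun u => by rw [ea]; ring)).congr_deriv (by rw [ea₁]; ring)
  have hdb : ∀ t, HasDerivAt b (b₁ t) t := fun t =>
    (hasDerivAt_quad (-45) 680 (-15300) t (fun u => by rw [eb]; ring)).congr_deriv (by rw [eb₁]; ring)
  have hdc : ∀ t, HasDerivAt c (c₁ t) t := fun t =>
    (hasDerivAt_quad 650 0 0 t (fun u => by rw [ec]; ring)).congr_deriv (by rw [ec₁]; ring)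
  have hsa : ∀ σ : Set (Fin 1 → ℝ), IsSemialgebraic ℚ σ → IsSemialgebraicFunOn ℚ σ (fun p => a (p 0)) :=
    fun σ hσ => poly_semialgebraic hσ (MvPolynomial.X 0 ^ 2 - 44 * MvPolynomial.X 0 + 990) a
      (fun x => by rw [ea]; simp)
  have hsb : ∀ σ : Set (Fin 1 → ℝ), IsSemialgebraic ℚ σ → IsSemialgebraicFunOn ℚ σ (fun p => b (p 0)) :=
    fun σ hσ => poly_semialgebraic hσ (-45 * MvPolynomial.X 0 ^ 2 + 680 * MvPolynomial.X 0 - 15300) b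
      (fun x => by rw [eb]; simp)
  have hsc : ∀ σ : Set (Fin 1 → ℝ), IsSemialgebraic ℚ σ → IsSemialgebraicFunOn ℚ σ (fun p => c (p 0)) :=
    fun σ hσ => poly_semialgebraic hσ (650 * MvPolynomial.X 0 ^ 2) c (fun x => by rw [ec]; simp)
  have hsa₁ : ∀ σ : Set (Fin 1 → ℝ), IsSemialgebraic ℚ σ → IsSemialgebraicFunOn ℚ σ (fun p => a₁ (p 0)) :=
    fun σ hσ => poly_semialgebraic hσ (2 * MvPolynomial.X 0 - 44) a₁ (fun x => by rw [ea₁]; simp)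
  have hsb₁ : ∀ σ : Set (Fin 1 → ℝ), IsSemialgebraic ℚ σ → IsSemialgebraicFunOn ℚ σ (fun p => b₁ (p 0)) :=
    fun σ hσ => poly_semialgebraic hσ (-90 * MvPolynomial.X 0 + 680) b₁ (fun x => by rw [eb₁]; simp)
  have hsc₁ : ∀ σ : Set (Fin 1 → ℝ), IsSemialgebraic ℚ σ → IsSemialgebraicFunOn ℚ σ (fun p => c₁ (p 0)) :=
    fun σ hσ => poly_semialgebraic hσ (1300 * MvPolynomial.X 0) c₁ (fun x => by rw [ec₁]; simp)
  have hΦP : ∀ y t : ℝ, a t * y ^ 2 + b t * y + c t = 0 →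
      (y ^ 2 - 45 * y + 650) * t ^ 2 + (-44 * y ^ 2 + 680 * y) * t + (990 * y ^ 2 - 15300 * y) = 0 := by
    intro y t h; rw [ea, eb, ec] at h; linear_combination h
  have hnorm : ∀ y t : ℝ, a t * y ^ 2 + b t * y + c t = 0 → Ft y * Fs t = Ψ y t ^ 2 := by
    intro y t h
    have c0 := cert0_norm y t
    rw [hΦP y t h, zero_mul, sub_eq_zero] at c0
    rw [eFt, eFs, eΨ]
    linear_combination c0
  have hcert : ∀ y t : ℝ, a t * y ^ 2 + b t * y + c t = 0 →
      Ft y * (2 * a t * y + b t) + 1 * (P y * (y + t) + Q y) * Ψ y t = 0 := by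
    intro y t h
    have c0 := cert0_trace_x y t
    rw [hΦP y t h, zero_mul] at c0
    rw [eFt, ea, eb, eP, eQ, eΨ]
    linear_combination c0
  have ha : ∀ t : ℝ, ((36 : ℚ) : ℝ) < t → t < ((60 : ℚ) : ℝ) → 0 < a t := by
    intro t _ _; rw [ea]; nlinarith [sq_nonneg (t - 22)]
  have hd : ∀ t : ℝ, ((36 : ℚ) : ℝ) < t → t < ((60 : ℚ) : ℝ) → t ≠ ((45 : ℚ) : ℝ) →
      0 < b t ^ 2 - 4 * a t * c t := by
    intro t h1 h2 _
    push_cast at h1 h2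
    rw [ea, eb, ec, show (-45 * t ^ 2 + 680 * t - 15300) ^ 2 - 4 * (t ^ 2 - 44 * t + 990) * (650 * t ^ 2) =
      25 * (t + 18) * (t - 10) * (t - 34) * (1530 - 23 * t) by ring]
    exact mul_pos (mul_pos (mul_pos (mul_pos (by norm_num) (by linarith)) (by linarith)) (by linarith))
      (by linarith)
  -- the quadratic in `x` over a point `t` of the source: continuity and values at 40, 45, 13, 30
  have hcx : ∀ t : ℝ, Continuous (fun y : ℝ => a t * y ^ 2 + b t * y + c t) := by
    intro t; rw [ea, eb, ec]; fun_prop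
  have hv40 : ∀ t : ℝ, a t * (40 : ℝ) ^ 2 + b t * 40 + c t = 450 * (t - 36) * (t - 60) := by
    intro t; rw [ea, eb, ec]; ring
  have hv45 : ∀ t : ℝ, a t * (45 : ℝ) ^ 2 + b t * 45 + c t = 650 * (t - 45) ^ 2 := by
    intro t; rw [ea, eb, ec]; ring
  have hv13 : ∀ t : ℝ, a t * (13 : ℝ) ^ 2 + b t * 13 + c t = 234 * (t + 15) * (t - 9) := by
    intro t; rw [ea, eb, ec]; ring
  have hv30 : ∀ t : ℝ, a t * (30 : ℝ) ^ 2 + b t * 30 + c t = 200 * (t - 36) * (t - 60) := by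
    intro t; rw [ea, eb, ec]; ring
  have hyroots : ∀ t : ℝ, ((36 : ℚ) : ℝ) < t → t < ((60 : ℚ) : ℝ) → t ≠ ((45 : ℚ) : ℝ) →
      (∃ y : ℝ, ((40 : ℚ) : ℝ) < y ∧ y < ((45 : ℚ) : ℝ) ∧ a t * y ^ 2 + b t * y + c t = 0) ∧
        ∃ y' : ℝ, ((13 : ℚ) : ℝ) < y' ∧ y' < ((30 : ℚ) : ℝ) ∧ a t * y' ^ 2 + b t * y' + c t = 0 := by
    intro t ht1 ht2 ht0
    push_cast at ht1 ht2 ht0 ⊢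
    have hneg : (t - 36) * (t - 60) < 0 := mul_neg_of_pos_of_neg (by linarith) (by linarith)
    have hpos : 0 < (t + 15) * (t - 9) := mul_pos (by linarith) (by linarith)
    have hsq : 0 < (t - 45) ^ 2 := by
      have : t - 45 ≠ 0 := sub_ne_zero.mpr ht0
      positivity
    constructor
    · have h0 : (0 : ℝ) ∈ Ioo (a t * (40 : ℝ) ^ 2 + b t * 40 + c t) (a t * (45 : ℝ) ^ 2 + b t * 45 + c t) := by
        rw [hv40, hv45]
        exact ⟨by nlinarith, by nlinarith⟩
      obtain ⟨y, hy, hy0⟩ := intermediate_value_Ioo (show (40 : ℝ) ≤ 45 by norm_num) (hcx t).continuousOn h0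
      exact ⟨y, hy.1, hy.2, hy0⟩
    · have h0 : (0 : ℝ) ∈ Ioo (a t * (30 : ℝ) ^ 2 + b t * 30 + c t) (a t * (13 : ℝ) ^ 2 + b t * 13 + c t) := by
        rw [hv13, hv30]
        exact ⟨by nlinarith, by nlinarith⟩
      obtain ⟨y, hy, hy0⟩ := intermediate_value_Ioo' (show (13 : ℝ) ≤ 30 by norm_num) (hcx t).continuousOn h0
      exact ⟨y, hy.1, hy.2, hy0⟩
  have hsep : ∀ y y' : ℝ, ((40 : ℚ) : ℝ) < y → y < ((45 : ℚ) : ℝ) → ((13 : ℚ) : ℝ) < y' → y' < ((30 : ℚ) : ℝ) →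
      0 < (((1 : ℚ)) : ℝ) * (y - y') := by
    intro y y' hy _ _ hy'
    push_cast at hy hy' ⊢
    nlinarith
  have hP : ∀ y : ℝ, ((40 : ℚ) : ℝ) < y → y < ((45 : ℚ) : ℝ) → P y ≠ 0 := by
    intro y _ _; rw [eP]; nlinarith [sq_nonneg (2 * y - 45)]
  -- the quadratic in `t` over a point `y` of the target: continuity and values at 36, y, 45, 60
  have hct : ∀ y : ℝ, Continuous (fun t : ℝ => a t * y ^ 2 + b t * y + c t) := by
    intro y; simp only [ea, eb, ec]; fun_prop
  have hw36 : ∀ y : ℝ, a 36 * y ^ 2 + b 36 * y + c 36 = 702 * (y - 30) * (y - 40) := by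
    intro y; rw [ea, eb, ec]; ring
  have hwy : ∀ y : ℝ, a y * y ^ 2 + b y * y + c y = y * (y - 45) * (y - 10) * (y - 34) := by
    intro y; rw [ea, eb, ec]; ring
  have hw45 : ∀ y : ℝ, a 45 * y ^ 2 + b 45 * y + c 45 = 45 * (y - 45) * (23 * y - 650) := by
    intro y; rw [ea, eb, ec]; ring
  have hw60 : ∀ y : ℝ, a 60 * y ^ 2 + b 60 * y + c 60 = 1950 * (y - 30) * (y - 40) := by
    intro y; rw [ea, eb, ec]; ring
  have htroots : ∀ y : ℝ, ((40 : ℚ) : ℝ) < y → y < ((45 : ℚ) : ℝ) →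
      (∃ t : ℝ, ((36 : ℚ) : ℝ) < t ∧ t < ((45 : ℚ) : ℝ) ∧ t < y ∧ a t * y ^ 2 + b t * y + c t = 0) ∧
        ∃ t : ℝ, ((45 : ℚ) : ℝ) < t ∧ t < ((60 : ℚ) : ℝ) ∧ y < t ∧ a t * y ^ 2 + b t * y + c t = 0 := by
    intro y hy1 hy2
    push_cast at hy1 hy2 ⊢
    have hpos : 0 < (y - 30) * (y - 40) := mul_pos (by linarith) (by linarith)
    constructor
    · -- a root in (36, y): Φ⁰(y,36) = 702(y−30)(y−40) > 0 > Φ⁰(y,y) = y(y−45)(y−10)(y−34)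
      have h0 : (0 : ℝ) ∈ Ioo (a y * y ^ 2 + b y * y + c y) (a 36 * y ^ 2 + b 36 * y + c 36) := by
        rw [hwy, hw36]
        refine ⟨?_, by nlinarith⟩
        have h1 : 0 < y * (45 - y) := mul_pos (by linarith) (by linarith)
        have h2 : 0 < (y - 10) * (y - 34) := mul_pos (by linarith) (by linarith)
        nlinarith [mul_pos h1 h2]
      obtain ⟨t, ht, ht0⟩ := intermediate_value_Ioo' (show (36 : ℝ) ≤ y by linarith) (hct y).continuousOn h0
      exact ⟨t, ht.1, by linarith [ht.2], ht.2, ht0⟩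
    · -- a root in (45, 60): Φ⁰(y,45) = 45(y−45)(23y−650) < 0 < Φ⁰(y,60) = 1950(y−30)(y−40)
      have h0 : (0 : ℝ) ∈ Ioo (a 45 * y ^ 2 + b 45 * y + c 45) (a 60 * y ^ 2 + b 60 * y + c 60) := by
        rw [hw45, hw60]
        refine ⟨?_, by nlinarith⟩
        nlinarith [mul_pos (by linarith : (0 : ℝ) < 45 - y) (by linarith : (0 : ℝ) < 23 * y - 650)]
      obtain ⟨t, ht, ht0⟩ := intermediate_value_Ioo (show (45 : ℝ) ≤ 60 by norm_num) (hct y).continuousOn h0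
      exact ⟨t, ht.1, ht.2, by linarith [ht.1], ht0⟩
  have hDz : ∀ y : ℝ, ((40 : ℚ) : ℝ) < y → y < ((45 : ℚ) : ℝ) → Q y ^ 2 - 4 * P y * R y ≠ 0 := by
    intro y hy1 hy2
    push_cast at hy1 hy2
    rw [eP, eQ, eR, show (-44 * y ^ 2 + 680 * y) ^ 2 - 4 * (y ^ 2 - 45 * y + 650) * (990 * y ^ 2 - 15300 * y) =
      -8 * y * (11 * y - 170) * (23 * y - 650) * (y - 45) by ring]
    refine mul_ne_zero (mul_ne_zero (mul_ne_zero (mul_ne_zero (by norm_num) ?_) ?_) ?_) ?_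
    · exact (by linarith : (0 : ℝ) < y).ne'
    · exact (by linarith : (0 : ℝ) < 11 * y - 170).ne'
    · exact (by linarith : (0 : ℝ) < 23 * y - 650).ne'
    · exact (by linarith : y - 45 < 0).ne
  have hFt : ∀ y : ℝ, ((40 : ℚ) : ℝ) < y → y < ((45 : ℚ) : ℝ) → Ft y ≠ 0 := by
    intro y hy1 hy2
    push_cast at hy1 hy2
    rw [eFt]
    refine mul_ne_zero (mul_ne_zero (mul_ne_zero (mul_ne_zero (mul_ne_zero ?_ ?_) ?_) ?_) ?_) ?_
    · exact (by linarith : (0 : ℝ) < y).ne'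
    · exact (by linarith : (0 : ℝ) < y - 6).ne'
    · exact (by linarith : (0 : ℝ) < y - 13).ne'
    · exact (by linarith : (0 : ℝ) < y - 30).ne'
    · exact (by linarith : (0 : ℝ) < y - 40).ne'
    · exact (by linarith : y - 45 < 0).ne
  have hFs : ∀ t : ℝ, ((36 : ℚ) : ℝ) < t → t < ((60 : ℚ) : ℝ) → t ≠ ((45 : ℚ) : ℝ) → Fs t ≠ 0 := by
    intro t ht1 ht2 _
    push_cast at ht1 ht2
    rw [eFs]
    refine mul_ne_zero (mul_ne_zero (mul_ne_zero (mul_ne_zero (mul_ne_zero ?_ ?_) ?_) ?_) ?_) ?_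
    · exact (by linarith : (0 : ℝ) < t + 15).ne'
    · exact (by linarith : (0 : ℝ) < t - 9).ne'
    · exact (by linarith : (0 : ℝ) < t - 10).ne'
    · exact (by linarith : (0 : ℝ) < t - 34).ne'
    · exact (by linarith : (0 : ℝ) < t - 36).ne'
    · exact (by linarith : t - 60 < 0).ne
  have hr : r.domain = {p | ((36 : ℚ) : ℝ) < p 0 ∧ p 0 < ((60 : ℚ) : ℝ)} := by push_cast; exact h1
  have hs : r'.domain = {p | ((40 : ℚ) : ℝ) < p 0 ∧ p 0 < ((45 : ℚ) : ℝ)} := by push_cast; exact h3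
  have hg : EqOn r.integrand (fun p => 1 * ((α : ℝ) + (β : ℝ) * p 0) / Real.sqrt |Fs (p 0)|) r.domain := by
    intro p hp; rw [h2 hp]; beta_reduce; rw [eFs, one_mul]
  have hf : EqOn r'.integrand (fun p => 1 * ((α : ℝ) + (β : ℝ) * p 0) / Real.sqrt |Ft (p 0)|) r'.domain := by
    intro p hp; rw [h4 hp]
  exact correspondence_transfer a b c a₁ b₁ c₁ P Q R Ft Fs Ψ 1 1 1 (α : ℝ) (β : ℝ) 1 36 45 60 40 45 13 30
    r r' (Or.inr rfl) (by norm_num) (by norm_num) hexp hda hdb hdc hsa hsb hsc hsa₁ hsb₁ hsc₁ hnorm hcert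
    (by simp) ha hd hyroots hsep hP htroots hDz hFt hFs hr hg hs hf

end Summit.KontsevichZagierPeriods.IsogenyCertificates.RichelotChain

end
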